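import Summits.CriticalPhenomena.CardyFormulaZ2.Theorems.CardyBoundaryCoulombGasRectilinearCardyJunctionWedge

/-!
# Stub `stub_transportPaths` of line `rainbow-monomials-in-excursion-kernels` — Part 1:
# the wedge at every boundary point of a rectilinear Jordan domain
# (crux `CardyBoundaryCoulombGas.BoundaryDefectGaussianR`, stmt-CriticalPhenomena-14132)

Local structure (T2) of the frontier of a Jordan domain `D` covered by finitely many axis-parallel
segments (the `∃ S, …` hypothesis of TRANSPORT), at the image `p = γ t₀` of an ARBITRARY parameter
`t₀` of the boundary loop `γ = D.boundary`:

* `tp_injOn_Ico` — `γ` is injective on every window `[c, c + 1)`;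
* `tp_germs` — the outgoing germ `γ|[t₀, t₀ + η]` runs along an axis ray `p + [0, ∞) i^a` with
  `t ↦ ‖γ t - p‖` strictly increasing, the incoming germ `γ|[t₀ - η, t₀]` along a DIFFERENT axis
  ray `p + [0, ∞) i^b` with `t ↦ ‖γ t - p‖` strictly decreasing (`η ≤ 1/4`);
* `tp_wedgeAt` — for some `r > 0`: every frontier point within `r` of `p` is `γ t` for a parameter
  `t ∈ (t₀ - η, t₀ + η)` (locality), the frontier within `r` of `p` is EXACTLY the union of the two
  rays (start rays of the frames `u = (z - p)(-i)^a` and `u = (z - p)(-i)^(a+m)`, `m ∈ {1, 2, 3}`),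
  and `D` within `r` of `p` is the standard sector of `m` quadrants swept counter-clockwise from
  the outgoing ray to the incoming ray, or the standard sector of `4 - m` quadrants swept from the
  incoming ray to the outgoing ray (`wedge_dichotomy` of the tree). Corners are the parameters with
  `m ≠ 2`.

Assembled from the tree's `exists_pos_forall_mem_cross`, `exists_dir_of_mem_cross`,
`exists_mem_Icc_eq_of_norm_le(')`, `wedge_dichotomy` (files
`…RectilinearCardyLocalSide/WedgeDichotomy/JunctionWedge`). All [folklore].
-/

noncomputable section

open Set Filter Metric Topology
open Literature.Probability.RandomPlanarGeometry
open Summit.CriticalPhenomena.CardyFormulaZ2.Cruxes.RectilinearCardy.ExcursionKernelCovariance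

namespace Summit.CriticalPhenomena.CardyFormulaZ2.Cruxes.BoundaryDefectGaussianR.RainbowMonomialsInExcursionKernels

/-- The boundary loop of a Jordan domain is injective on every half-open parameter window of
length `1` (injective on a period and `1`-periodic). [folklore] -/
theorem tp_injOn_Ico (D : JordanDomain) (c : ℝ) : InjOn D.boundary (Ico c (c + 1)) := by
  intro t ht t' ht' h
  have hper : ∀ x : ℝ, D.boundary (Int.fract x) = D.boundary x := fun x => by
    rw [← Int.self_sub_floor, ← mul_one (⌊x⌋ : ℝ)]
    exact D.periodic_boundary.sub_int_mul_eq ⌊x⌋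
  have h1 : D.boundary (Int.fract t) = D.boundary (Int.fract t') := by rw [hper, hper, h]
  have h2 := D.injOn_boundary ⟨Int.fract_nonneg t, Int.fract_lt_one t⟩
    ⟨Int.fract_nonneg t', Int.fract_lt_one t'⟩ h1
  obtain ⟨z, hz⟩ := Int.fract_eq_fract.mp h2
  have hz1 : |(z : ℝ)| < 1 := by
    rw [← hz, abs_lt]
    constructor <;> linarith [ht.1, ht.2, ht'.1, ht'.2]
  have hz0 : z = 0 := by
    have h3 : |z| < 1 := by exact_mod_cast hz1
    exact Int.abs_lt_one_iff.mp h3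
  rw [hz0, Int.cast_zero, sub_eq_zero] at hz
  exact hz

/-- **Germs of a rectilinear Jordan frontier.** At every parameter `t₀` of the boundary loop `γ`
of a Jordan domain whose frontier is covered by finitely many axis-parallel segments: for some
`0 < η ≤ 1/4` and two DIFFERENT exponents `a ≠ b` (below `4`), the outgoing germ satisfies
`γ t = γ t₀ + ‖γ t - γ t₀‖ i^a` on `[t₀, t₀ + η]` with `t ↦ ‖γ t - γ t₀‖` strictly increasing, and
the incoming germ satisfies `γ t = γ t₀ + ‖γ t - γ t₀‖ i^b` on `[t₀ - η, t₀]` with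
`t ↦ ‖γ t - γ t₀‖` strictly decreasing (cross through `γ t₀`, connectedness, injectivity of the
loop, intermediate value theorem). [folklore] -/
theorem tp_germs (D : JordanDomain) {S : Finset (ℂ × ℂ)}
    (hS : ∀ q ∈ S, q.1.re = q.2.re ∨ q.1.im = q.2.im)
    (hcov : frontier D.carrier ⊆ ⋃ q ∈ S, segment ℝ q.1 q.2) (t₀ : ℝ) :
    ∃ η : ℝ, 0 < η ∧ η ≤ 1 / 4 ∧ ∃ a b : ℕ, a < 4 ∧ b < 4 ∧ a ≠ b ∧
      (∀ t ∈ Icc t₀ (t₀ + η), D.boundary t =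
        D.boundary t₀ + ((‖D.boundary t - D.boundary t₀‖ : ℝ) : ℂ) * Complex.I ^ a) ∧
      StrictMonoOn (fun t => ‖D.boundary t - D.boundary t₀‖) (Icc t₀ (t₀ + η)) ∧
      (∀ t ∈ Icc (t₀ - η) t₀, D.boundary t =
        D.boundary t₀ + ((‖D.boundary t - D.boundary t₀‖ : ℝ) : ℂ) * Complex.I ^ b) ∧
      StrictAntiOn (fun t => ‖D.boundary t - D.boundary t₀‖) (Icc (t₀ - η) t₀) := by
  set γ := D.boundary with hγ
  set p := γ t₀ with hp
  have hγc : Continuous γ := D.continuous_boundary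
  have hinj : InjOn γ (Ico (t₀ - 1 / 2) (t₀ - 1 / 2 + 1)) := tp_injOn_Ico D (t₀ - 1 / 2)
  -- (A) the cross through `p`
  obtain ⟨r₁, hr₁, hcross⟩ := exists_pos_forall_mem_cross hS hcov p
  obtain ⟨η₀, hη₀, hη₀r⟩ : ∃ η₀ > 0, ∀ t, |t - t₀| < η₀ → dist (γ t) p < r₁ := by
    obtain ⟨η₀, hη₀, h⟩ := Metric.continuousAt_iff.1 (hγc.continuousAt (x := t₀)) r₁ hr₁
    exact ⟨η₀, hη₀, fun t ht => h (by rwa [Real.dist_eq])⟩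
  set η := min η₀ (1 / 4) / 2 with hηdef
  have hmin : 0 < min η₀ (1 / 4) := lt_min hη₀ (by norm_num)
  have hη : 0 < η := by rw [hηdef]; linarith
  have h2η₀ : 2 * η ≤ η₀ := by rw [hηdef]; linarith [min_le_left η₀ (1 / 4)]
  have h2η4 : 2 * η ≤ 1 / 4 := by rw [hηdef]; linarith [min_le_right η₀ (1 / 4)]
  have hne : ∀ t, t₀ - 2 * η < t → t < t₀ + 2 * η → t ≠ t₀ → γ t ≠ p := by
    intro t h1 h2 hne h
    exact hne (hinj ⟨by linarith, by linarith⟩ ⟨by linarith, by linarith⟩ h)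
  -- (B) directions of the two germs
  have hcrossA : ∀ t ∈ Ioo t₀ (t₀ + 2 * η), (γ t).re = p.re ∨ (γ t).im = p.im := fun t ht =>
    hcross _ (D.boundary_mem_frontier t)
      (hη₀r t (by rw [abs_lt]; constructor <;> linarith [ht.1, ht.2]))
  have hneA : ∀ t ∈ Ioo t₀ (t₀ + 2 * η), γ t ≠ p := fun t ht =>
    hne t (by linarith [ht.1]) ht.2 (ne_of_gt ht.1)
  have hcrossB : ∀ t ∈ Ioo (t₀ - 2 * η) t₀, (γ t).re = p.re ∨ (γ t).im = p.im := fun t ht =>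
    hcross _ (D.boundary_mem_frontier t)
      (hη₀r t (by rw [abs_lt]; constructor <;> linarith [ht.1, ht.2]))
  have hneB : ∀ t ∈ Ioo (t₀ - 2 * η) t₀, γ t ≠ p := fun t ht =>
    hne t ht.1 (by linarith [ht.2]) (ne_of_lt ht.2)
  obtain ⟨dA, hdA, hdirA⟩ := exists_dir_of_mem_cross hγc hcrossA hneA
  obtain ⟨dB, hdB, hdirB⟩ := exists_dir_of_mem_cross hγc hcrossB hneB
  obtain ⟨a, ha4, rfl⟩ := exists_eq_I_pow hdA
  obtain ⟨b, hb4, rfl⟩ := exists_eq_I_pow hdB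
  have hp0 : γ t₀ = p + ((‖γ t₀ - p‖ : ℝ) : ℂ) * Complex.I ^ a := by
    rw [hp, sub_self, norm_zero]; simp
  have hp0' : γ t₀ = p + ((‖γ t₀ - p‖ : ℝ) : ℂ) * Complex.I ^ b := by
    rw [hp, sub_self, norm_zero]; simp
  have hdirA' : ∀ t ∈ Icc t₀ (t₀ + η), γ t = p + ((‖γ t - p‖ : ℝ) : ℂ) * Complex.I ^ a := by
    intro t ht
    rcases ht.1.eq_or_lt with h | hlt
    · rw [← h]; exact hp0
    · exact hdirA t ⟨hlt, by linarith [ht.2]⟩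
  have hdirB' : ∀ t ∈ Icc (t₀ - η) t₀, γ t = p + ((‖γ t - p‖ : ℝ) : ℂ) * Complex.I ^ b := by
    intro t ht
    rcases ht.2.eq_or_lt with h | hlt
    · rw [h]; exact hp0'
    · exact hdirB t ⟨by linarith [ht.1], hlt⟩
  -- (C) monotonicity of the distance to `p`
  have hfc : Continuous fun t => ‖γ t - p‖ := by fun_prop
  have hf0 : ‖γ t₀ - p‖ = 0 := by rw [hp, sub_self, norm_zero]
  have hinjA : InjOn (fun t => ‖γ t - p‖) (Icc t₀ (t₀ + η)) := by
    intro t ht t' ht' h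
    simp only at h
    have heq : γ t = γ t' := by rw [hdirA' t ht, hdirA' t' ht', h]
    exact hinj ⟨by linarith [ht.1], by linarith [ht.2]⟩ ⟨by linarith [ht'.1], by linarith [ht'.2]⟩
      heq
  have hinjB : InjOn (fun t => ‖γ t - p‖) (Icc (t₀ - η) t₀) := by
    intro t ht t' ht' h
    simp only at h
    have heq : γ t = γ t' := by rw [hdirB' t ht, hdirB' t' ht', h]
    exact hinj ⟨by linarith [ht.1], by linarith [ht.2]⟩ ⟨by linarith [ht'.1], by linarith [ht'.2]⟩
      heq
  have hmonoA : StrictMonoOn (fun t => ‖γ t - p‖) (Icc t₀ (t₀ + η)) :=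
    hfc.continuousOn.strictMonoOn_of_injOn_Icc (by linarith)
      (by simpa only [hf0] using norm_nonneg (γ (t₀ + η) - p)) hinjA
  have hantiB : StrictAntiOn (fun t => ‖γ t - p‖) (Icc (t₀ - η) t₀) :=
    hfc.continuousOn.strictAntiOn_of_injOn_Icc (by linarith)
      (by simpa only [hf0] using norm_nonneg (γ (t₀ - η) - p)) hinjB
  -- (D) the two directions differ
  have hab : a ≠ b := by
    intro h
    subst h
    have hsA : 0 < ‖γ (t₀ + η) - p‖ := by
      have h1 := hmonoA ⟨le_rfl, by linarith⟩ ⟨by linarith, le_rfl⟩ (by linarith : t₀ < t₀ + η)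
      simp only at h1
      rwa [hf0] at h1
    have hsB : 0 < ‖γ (t₀ - η) - p‖ := by
      have h1 := hantiB ⟨le_rfl, by linarith⟩ ⟨by linarith, le_rfl⟩ (by linarith : t₀ - η < t₀)
      simp only at h1
      rwa [hf0] at h1
    set s := min ‖γ (t₀ + η) - p‖ ‖γ (t₀ - η) - p‖ with hs
    have hs0 : 0 < s := lt_min hsA hsB
    obtain ⟨t, ht, hts⟩ :=
      exists_mem_Icc_eq_of_norm_le' hγc (by linarith) hdirA' rfl hs0.le (min_le_left _ _)
    obtain ⟨t', ht', ht's⟩ :=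
      exists_mem_Icc_eq_of_norm_le hγc (by linarith) hdirB' rfl hs0.le (min_le_right _ _)
    have heq : t = t' := hinj ⟨by linarith [ht.1], by linarith [ht.2]⟩
      ⟨by linarith [ht'.1], by linarith [ht'.2]⟩ (hts.trans ht's.symm)
    have htt₀ : t = t₀ := le_antisymm (heq ▸ ht'.2) ht.1
    rw [htt₀] at hts
    have hzero : (s : ℂ) * Complex.I ^ a = 0 := by
      have h2 : p + (s : ℂ) * Complex.I ^ a = p + 0 := by rw [add_zero]; exact hts.symm
      exact add_left_cancel h2
    rw [mul_eq_zero] at hzero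
    rcases hzero with h | h
    · exact hs0.ne' (by exact_mod_cast h)
    · exact (pow_ne_zero a Complex.I_ne_zero) h
  exact ⟨η, hη, by linarith, a, b, ha4, hb4, hab, hdirA', hmonoA, hdirB', hantiB⟩

/-- **The wedge at every boundary point of a rectilinear Jordan domain (T2).** Let the frontier
of the Jordan domain `D` be covered by finitely many axis-parallel segments, `γ = D.boundary`,
`t₀ : ℝ`, `p = γ t₀`. Then for some `r > 0`, `0 < η ≤ 1/4`, `a < 4`, `m ∈ {1, 2, 3}`:
the outgoing germ `γ|[t₀, t₀ + η]` runs strictly monotonically along the ray `p + [0, ∞) i^a`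
beyond radius `r`, the incoming germ `γ|[t₀ - η, t₀]` strictly monotonically along
`p + [0, ∞) i^(a+m)` beyond radius `r`; every frontier point within `r` of `p` is `γ t` for some
`t ∈ (t₀ - η, t₀ + η)`; the frontier within `r` of `p` is exactly the union of the two rays
(start rays of the frames `u = (z - p)(-i)^a`, `u = (z - p)(-i)^(a+m)`); and within `r` of `p`
the domain is the standard sector of `m` quadrants of the first frame (swept counter-clockwise
from the outgoing to the incoming ray) or the standard sector of `4 - m` quadrants of the second
frame. Corners are the parameters with `m ≠ 2`. [folklore] -/
theorem tp_wedgeAt (D : JordanDomain) {S : Finset (ℂ × ℂ)}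
    (hS : ∀ q ∈ S, q.1.re = q.2.re ∨ q.1.im = q.2.im)
    (hcov : frontier D.carrier ⊆ ⋃ q ∈ S, segment ℝ q.1 q.2) (t₀ : ℝ) :
    ∃ r η : ℝ, ∃ a m : ℕ, 0 < r ∧ 0 < η ∧ η ≤ 1 / 4 ∧ a < 4 ∧ (m = 1 ∨ m = 2 ∨ m = 3) ∧
      (∀ t ∈ Icc t₀ (t₀ + η), D.boundary t =
        D.boundary t₀ + ((‖D.boundary t - D.boundary t₀‖ : ℝ) : ℂ) * Complex.I ^ a) ∧
      StrictMonoOn (fun t => ‖D.boundary t - D.boundary t₀‖) (Icc t₀ (t₀ + η)) ∧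
      r < ‖D.boundary (t₀ + η) - D.boundary t₀‖ ∧
      (∀ t ∈ Icc (t₀ - η) t₀, D.boundary t =
        D.boundary t₀ + ((‖D.boundary t - D.boundary t₀‖ : ℝ) : ℂ) * Complex.I ^ (a + m)) ∧
      StrictAntiOn (fun t => ‖D.boundary t - D.boundary t₀‖) (Icc (t₀ - η) t₀) ∧
      r < ‖D.boundary (t₀ - η) - D.boundary t₀‖ ∧
      (∀ z ∈ frontier D.carrier, dist z (D.boundary t₀) < r →
        ∃ t ∈ Ioo (t₀ - η) (t₀ + η), z = D.boundary t) ∧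
      (∀ z, dist z (D.boundary t₀) < r → (z ∈ frontier D.carrier ↔
        (((z - D.boundary t₀) * (-Complex.I) ^ a).im = 0 ∧
            0 ≤ ((z - D.boundary t₀) * (-Complex.I) ^ a).re) ∨
          (((z - D.boundary t₀) * (-Complex.I) ^ (a + m)).im = 0 ∧
            0 ≤ ((z - D.boundary t₀) * (-Complex.I) ^ (a + m)).re))) ∧
      ((∀ z, dist z (D.boundary t₀) < r → (z ∈ D.carrier ↔
          (m = 1 → 0 < ((z - D.boundary t₀) * (-Complex.I) ^ a).re ∧
              0 < ((z - D.boundary t₀) * (-Complex.I) ^ a).im) ∧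
            (m = 2 → 0 < ((z - D.boundary t₀) * (-Complex.I) ^ a).im) ∧
            (m = 3 → 0 < ((z - D.boundary t₀) * (-Complex.I) ^ a).im ∨
              ((z - D.boundary t₀) * (-Complex.I) ^ a).re < 0))) ∨
        (∀ z, dist z (D.boundary t₀) < r → (z ∈ D.carrier ↔
          (4 - m = 1 → 0 < ((z - D.boundary t₀) * (-Complex.I) ^ (a + m)).re ∧
              0 < ((z - D.boundary t₀) * (-Complex.I) ^ (a + m)).im) ∧
            (4 - m = 2 → 0 < ((z - D.boundary t₀) * (-Complex.I) ^ (a + m)).im) ∧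
            (4 - m = 3 → 0 < ((z - D.boundary t₀) * (-Complex.I) ^ (a + m)).im ∨
              ((z - D.boundary t₀) * (-Complex.I) ^ (a + m)).re < 0)))) := by
  obtain ⟨η, hη, hη4, a, b, ha4, hb4, hab, hdirA, hmonoA, hdirB, hantiB⟩ := tp_germs D hS hcov t₀
  set γ := D.boundary with hγ
  set p := γ t₀ with hp
  have hγc : Continuous γ := D.continuous_boundary
  have hpf : p ∈ frontier D.carrier := D.boundary_mem_frontier t₀
  -- the exponent `m`
  set m := (b + 4 - a) % 4 with hmdef
  have hmod : (a + m) % 4 = b % 4 := by rw [hmdef]; omega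
  have hIm : Complex.I ^ (a + m) = Complex.I ^ b := by
    rw [Complex.I_pow_eq_pow_mod, hmod, ← Complex.I_pow_eq_pow_mod]
  have hm123 : m = 1 ∨ m = 2 ∨ m = 3 := by rw [hmdef]; omega
  have hdirB' : ∀ t ∈ Icc (t₀ - η) t₀,
      γ t = p + ((‖γ t - p‖ : ℝ) : ℂ) * Complex.I ^ (a + m) := by
    intro t ht; rw [hIm]; exact hdirB t ht
  have hf0 : ‖γ t₀ - p‖ = 0 := by rw [hp, sub_self, norm_zero]
  -- the two germ radii
  have hfA : 0 < ‖γ (t₀ + η) - p‖ := by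
    have h1 := hmonoA ⟨le_rfl, by linarith⟩ ⟨by linarith, le_rfl⟩ (by linarith : t₀ < t₀ + η)
    simp only at h1
    rwa [hf0] at h1
  have hfB : 0 < ‖γ (t₀ - η) - p‖ := by
    have h1 := hantiB ⟨le_rfl, by linarith⟩ ⟨by linarith, le_rfl⟩ (by linarith : t₀ - η < t₀)
    simp only at h1
    rwa [hf0] at h1
  -- the far part of the loop stays away from `p`
  set K := γ '' Icc (t₀ + η) (t₀ + 1 - η) with hK
  have hKc : IsCompact K := isCompact_Icc.image hγc
  have hKne : K.Nonempty := (nonempty_Icc.2 (by linarith)).image γ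
  have hpK : p ∉ K := by
    rintro ⟨t, ht, htp⟩
    have h1 : γ (t₀ + 1) = p := by rw [hp]; exact D.periodic_boundary t₀
    have := tp_injOn_Ico D (t₀ + η) ⟨ht.1, by linarith [ht.2]⟩ ⟨by linarith, by linarith⟩
      (htp.trans h1.symm)
    linarith [ht.2]
  have hKd : 0 < infDist p K := (hKc.isClosed.notMem_iff_infDist_pos hKne).1 hpK
  -- the radius
  have hM : 0 < min (infDist p K) (min ‖γ (t₀ + η) - p‖ ‖γ (t₀ - η) - p‖) :=
    lt_min hKd (lt_min hfA hfB)
  set r := min (infDist p K) (min ‖γ (t₀ + η) - p‖ ‖γ (t₀ - η) - p‖) / 2 with hrdef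
  have hr : 0 < r := by rw [hrdef]; linarith
  have hrK : 2 * r ≤ infDist p K := by
    rw [hrdef]; linarith [min_le_left (infDist p K) (min ‖γ (t₀ + η) - p‖ ‖γ (t₀ - η) - p‖)]
  have hrA : r < ‖γ (t₀ + η) - p‖ := by
    rw [hrdef]
    have h1 := min_le_right (infDist p K) (min ‖γ (t₀ + η) - p‖ ‖γ (t₀ - η) - p‖)
    have h2 := min_le_left ‖γ (t₀ + η) - p‖ ‖γ (t₀ - η) - p‖
    linarith
  have hrB : r < ‖γ (t₀ - η) - p‖ := by
    rw [hrdef]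
    have h1 := min_le_right (infDist p K) (min ‖γ (t₀ + η) - p‖ ‖γ (t₀ - η) - p‖)
    have h2 := min_le_right ‖γ (t₀ + η) - p‖ ‖γ (t₀ - η) - p‖
    linarith
  -- (i) locality in the parameter
  have hloc : ∀ z ∈ frontier D.carrier, dist z p < r →
      ∃ t ∈ Ioo (t₀ - η) (t₀ + η), z = γ t := by
    intro z hz hzr
    rw [← D.range_boundary] at hz
    obtain ⟨s, rfl⟩ := hz
    set n := ⌊s - (t₀ - η)⌋ with hn
    have hs'γ : γ (s - n * 1) = γ s := D.periodic_boundary.sub_int_mul_eq n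
    rw [mul_one] at hs'γ
    have hs'1 : t₀ - η ≤ s - n := by have := Int.floor_le (s - (t₀ - η)); linarith
    have hs'2 : s - n < t₀ - η + 1 := by have := Int.lt_floor_add_one (s - (t₀ - η)); linarith
    refine ⟨s - n, ⟨?_, ?_⟩, hs'γ.symm⟩
    · rcases hs'1.eq_or_lt with h | h
      · exfalso
        have : dist (γ s) p = ‖γ (t₀ - η) - p‖ := by rw [← hs'γ, ← h, dist_eq_norm]
        linarith
      · exact h
    · by_contra h
      push Not at h
      have hmem : γ s ∈ K := ⟨s - n, ⟨h, by linarith⟩, hs'γ⟩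
      have := infDist_le_dist_of_mem (x := p) hmem
      rw [dist_comm] at this
      linarith
  -- (ii) the germs lie on the start rays of the two frames
  have honA : ∀ t ∈ Icc t₀ (t₀ + η), ((γ t - p) * (-Complex.I) ^ a).im = 0 ∧
      0 ≤ ((γ t - p) * (-Complex.I) ^ a).re := by
    intro t ht
    have h : (γ t - p) * (-Complex.I) ^ a = ((‖γ t - p‖ : ℝ) : ℂ) := by
      conv_lhs => rw [hdirA t ht]
      rw [add_sub_cancel_left, mul_assoc, I_pow_mul_neg_I_pow, mul_one]
    rw [h]
    exact ⟨Complex.ofReal_im _, by rw [Complex.ofReal_re]; exact norm_nonneg _⟩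
  have honB : ∀ t ∈ Icc (t₀ - η) t₀, ((γ t - p) * (-Complex.I) ^ (a + m)).im = 0 ∧
      0 ≤ ((γ t - p) * (-Complex.I) ^ (a + m)).re := by
    intro t ht
    have h : (γ t - p) * (-Complex.I) ^ (a + m) = ((‖γ t - p‖ : ℝ) : ℂ) := by
      conv_lhs => rw [hdirB' t ht]
      rw [add_sub_cancel_left, mul_assoc, I_pow_mul_neg_I_pow, mul_one]
    rw [h]
    exact ⟨Complex.ofReal_im _, by rw [Complex.ofReal_re]; exact norm_nonneg _⟩
  -- (iii) the frontier near `p` is exactly the two rays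
  have hfront : ∀ z, dist z p < r → (z ∈ frontier D.carrier ↔
      (((z - p) * (-Complex.I) ^ a).im = 0 ∧ 0 ≤ ((z - p) * (-Complex.I) ^ a).re) ∨
        (((z - p) * (-Complex.I) ^ (a + m)).im = 0 ∧
          0 ≤ ((z - p) * (-Complex.I) ^ (a + m)).re)) := by
    intro z hz
    constructor
    · intro hzf
      obtain ⟨t, ht, rfl⟩ := hloc z hzf hz
      rcases le_or_gt t₀ t with h | h
      · exact Or.inl (honA t ⟨h, ht.2.le⟩)
      · exact Or.inr (honB t ⟨ht.1.le, h.le⟩)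
    · rintro (⟨him, hre⟩ | ⟨him, hre⟩)
      · set u := (z - p) * (-Complex.I) ^ a with hu
        have hureal : u = ((u.re : ℝ) : ℂ) := Complex.ext (by simp) (by simp [him])
        have hzp : z - p = u * Complex.I ^ a := by
          rw [hu, mul_assoc, neg_I_pow_mul_I_pow, mul_one]
        have hzu : z = p + ((u.re : ℝ) : ℂ) * Complex.I ^ a := by
          rw [← hureal]; linear_combination hzp
        have hnorm : ‖z - p‖ = u.re := by
          rw [hzp, hureal, norm_mul, norm_pow, Complex.norm_I, one_pow, mul_one,
            Complex.norm_real, Real.norm_of_nonneg hre, Complex.ofReal_re]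
        have hur : u.re ≤ ‖γ (t₀ + η) - p‖ := by
          rw [← hnorm, ← dist_eq_norm]; linarith
        obtain ⟨t, -, hts⟩ := exists_mem_Icc_eq_of_norm_le' hγc (by linarith) hdirA rfl hre hur
        rw [hzu, ← hts]
        exact D.boundary_mem_frontier t
      · set u := (z - p) * (-Complex.I) ^ (a + m) with hu
        have hureal : u = ((u.re : ℝ) : ℂ) := Complex.ext (by simp) (by simp [him])
        have hzp : z - p = u * Complex.I ^ (a + m) := by
          rw [hu, mul_assoc, neg_I_pow_mul_I_pow, mul_one]
        have hzu : z = p + ((u.re : ℝ) : ℂ) * Complex.I ^ (a + m) := by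
          rw [← hureal]; linear_combination hzp
        have hnorm : ‖z - p‖ = u.re := by
          rw [hzp, hureal, norm_mul, norm_pow, Complex.norm_I, one_pow, mul_one,
            Complex.norm_real, Real.norm_of_nonneg hre, Complex.ofReal_re]
        have hur : u.re ≤ ‖γ (t₀ - η) - p‖ := by
          rw [← hnorm, ← dist_eq_norm]; linarith
        obtain ⟨t, -, hts⟩ := exists_mem_Icc_eq_of_norm_le hγc (by linarith) hdirB' rfl hre hur
        rw [hzu, ← hts]
        exact D.boundary_mem_frontier t
  -- (iv) the wedge dichotomy
  have hdich := wedge_dichotomy D hpf hr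
    (A := {z | z ∈ frontier D.carrier ∧ (((z - p) * (-Complex.I) ^ a).im = 0 ∧
      0 ≤ ((z - p) * (-Complex.I) ^ a).re)})
    (B := {z | z ∈ frontier D.carrier ∧ (((z - p) * (-Complex.I) ^ (a + m)).im = 0 ∧
      0 ≤ ((z - p) * (-Complex.I) ^ (a + m)).re)})
    (fun z hz => hz.1) (fun z hz => hz.1)
    (fun z hzf hz => ((hfront z hz).1 hzf).imp (fun h => ⟨hzf, h⟩) fun h => ⟨hzf, h⟩) hm123
    (fun z hz => ⟨fun h => h.2, fun h => ⟨(hfront z hz).2 (Or.inl h), h⟩⟩)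
    (fun z hz => ⟨fun h => h.2, fun h => ⟨(hfront z hz).2 (Or.inr h), h⟩⟩)
  exact ⟨r, η, a, m, hr, hη, hη4, ha4, hm123, hdirA, hmonoA, hrA, hdirB', hantiB, hrB, hloc,
    hfront, hdich⟩

/-- **Registered sub-goal `s7_wedgeAt` of stub `stub_transportPaths`** (T2: the wedge at every
boundary point of a rectilinear Jordan domain, one-line form of `tp_wedgeAt`). [folklore] -/
theorem s7_wedgeAt : ∀ (D : Literature.Probability.RandomPlanarGeometry.JordanDomain) (S : Finset (ℂ × ℂ)), (∀ q ∈ S, q.1.re = q.2.re ∨ q.1.im = q.2.im) → frontier D.carrier ⊆ ⋃ q ∈ S, segment ℝ q.1 q.2 → ∀ (t₀ : ℝ), ∃ r η : ℝ, ∃ a m : ℕ, 0 < r ∧ 0 < η ∧ η ≤ 1 / 4 ∧ a < 4 ∧ (m = 1 ∨ m = 2 ∨ m = 3) ∧ (∀ t ∈ Set.Icc t₀ (t₀ + η), D.boundary t = D.boundary t₀ + ((‖D.boundary t - D.boundary t₀‖ : ℝ) : ℂ) * Complex.I ^ a) ∧ StrictMonoOn (fun t ↦ ‖D.boundary t - D.boundary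 t₀‖) (Set.Icc t₀ (t₀ + η)) ∧ r < ‖D.boundary (t₀ + η) - D.boundary t₀‖ ∧ (∀ t ∈ Set.Icc (t₀ - η) t₀, D.boundary t = D.boundary t₀ + ((‖D.boundary t - D.boundary t₀‖ : ℝ) : ℂ) * Complex.I ^ (a + m)) ∧ StrictAntiOn (fun t ↦ ‖D.boundary t - D.boundary t₀‖) (Set.Icc (t₀ - η) t₀) ∧ r < ‖D.boundary (t₀ - η) - D.boundary t₀‖ ∧ (∀ z ∈ frontier D.carrier, dist z (D.boundary t₀) < r → ∃ t ∈ Set.Ioo (t₀ - η) (t₀ + η), z = D.boundary t) ∧ (∀ z, dist z (D.boundary t₀) < r → (z ∈ frontier D.carrier ↔ (((z - D.boundary t₀) * (-Complex.I) ^ a).im = 0 ∧ 0 ≤ ((z - D.boundary t₀) * (-Complex.I) ^ a).re) ∨ (((z - D.boundary t₀) * (-Complex.I) ^ (a + m)).im = 0 ∧ 0 ≤ ((z - D.boundary t₀) * (-Complex.I) ^ (a + m)).re))) ∧ ((∀ z, dist z (D.boundary t₀) < r → (z ∈ D.carrier ↔ (m = 1 → 0 < ((z - D.boundary t₀) * (-Complex.I)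 ^ a).re ∧ 0 < ((z - D.boundary t₀) * (-Complex.I) ^ a).im) ∧ (m = 2 → 0 < ((z - D.boundary t₀) * (-Complex.I) ^ a).im) ∧ (m = 3 → 0 < ((z - D.boundary t₀) * (-Complex.I) ^ a).im ∨ ((z - D.boundary t₀) * (-Complex.I) ^ a).re < 0))) ∨ (∀ z, dist z (D.boundary t₀) < r → (z ∈ D.carrier ↔ (4 - m = 1 → 0 < ((z - D.boundary t₀) * (-Complex.I) ^ (a + m)).re ∧ 0 < ((z - D.boundary t₀) * (-Complex.I) ^ (a + m)).im) ∧ (4 - m = 2 → 0 < ((z - D.boundary t₀) * (-Complex.I) ^ (a + m)).im) ∧ (4 - m = 3 → 0 < ((z - D.boundary t₀) * (-Complex.I) ^ (a + m)).im ∨ ((z - D.boundary t₀) * (-Complex.I) ^ (a + m)).re < 0)))) :=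
  fun D _ hS hcov t₀ => tp_wedgeAt D hS hcov t₀

end Summit.CriticalPhenomena.CardyFormulaZ2.Cruxes.BoundaryDefectGaussianR.RainbowMonomialsInExcursionKernels

end
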